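import Mathlib
import Summits.ValiantsHypothesis.ValiantsHypothesis.Theses.ValuativeGCT
import Literature.Computability.AlgebraicComplexity.MultiplicityObstructionsProofs
import Literature.Computability.AlgebraicComplexity.PermanentVsDeterminantProofs
import Literature.Computability.AlgebraicComplexity.DeterminantalComplexityProofs
import Literature.Computability.AlgebraicComplexity.OrbitClosureProofs
import Literature.NumberTheory.DiophantineGeometry.SchurWeylPlethysmRenameProofs

/-!
# `NoValuativeFlip` (stmt-ValiantsHypothesis-12629) beyond Grenet's bound `m ≥ 2ⁿ - 1`

Route `ValuativeGCT`, support item `NoValuativeFlip` (kill statement: beyond some POLYNOMIAL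
padding `m ≥ n ^ c₀`, `mult_{λ*} ℂ[Δ(X₀₀^(m-n) per_n)] ≤ dim T_U(λ)` for every truncation and
every shape). This file proves the statement with the polynomial threshold replaced by Grenet's
EXPONENTIAL one, locating the content of the item precisely in the range `n ^ c₀ ≤ m < 2ⁿ - 1`:

* `hasDetRepr_perPoly_of_two_pow_le` — `per_n` has an affine determinantal representation of
  every size `m ≥ 2ⁿ - 1` (Grenet 2011, tree: `determinantalComplexity_perPoly_le_holds`,
  attainment `hasDetRepr_determinantalComplexity_holds` and padding `HasDetRepr.mono_holds`;
  `per_0 = 1 = det` of the empty matrix);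
* `paddedPerFormLex_mem_orbitClosure_detFormLex_of_two_pow_le` — hence
  `X₀₀^(m-n) per_n ∈ \overline{GL_{m²} · det_m}` for `m ≥ 2ⁿ - 1` (Mulmuley–Sohoni 2001 Prop. 4.4,
  tree: `paddedPerPoly_mem_orbitClosure_detPoly_of_hasDetRepr_holds`, transported to the
  lexicographic variables by `hasBorderDetRepr_iff_rename_holds`);
* `orbitMultiplicity_paddedPer_le_det_of_two_pow_le` — so NO multiplicity obstruction exists
  there: `mult_χ ℂ[Δ(X₀₀^(m-n) per_n)] ≤ mult_χ ℂ[Δ(det_m)]` for every weight `χ`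
  (multiplicity-obstruction principle, tree: `orbitMultiplicity_le_of_mem_orbitClosure_holds`);
  this is `GCTMult.GctNoMultBarrier` with threshold `2ⁿ - 1` in place of `n ^ c₀`, unconditional;
* `noValuativeFlip_body_of_two_pow_le` — and, given the route's `ValuativeBound`
  (`K_m(λ*) ≤ dim T_U(λ)`), the inequality of `NoValuativeFlip` for all `m ≥ 2ⁿ - 1`, all centres
  `(U, r)`, all `(δ, λ)`.

So `NoValuativeFlip` (and likewise `GctNoMultBarrier`) is exactly the assertion that the
threshold `2ⁿ - 1 = dc`-upper-bound can be lowered to a polynomial — the open problem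
(Bläser–Ikenmeyer 2025 §12.4); by `ValuativeGCTNoValuativeFlipReductions` its failure would give
`dc(per_n)` superpolynomial.

Sources: B. Grenet, *An upper bound for the permanent versus determinant problem* (2011), Thm. 1;
K. Mulmuley, M. Sohoni, SIAM J. Comput. 31 (2001), Prop. 4.4; BLMW 2011 §1; Bläser–Ikenmeyer,
ToC Graduate Surveys 10 (2025), §12.4.
-/

-- `Summit.ValiantsHypothesis.ValiantsHypothesis.…` repeats a component by the D-0017 layout
-- (single-conjunct summit), which the `dupNamespace` linter flags; the name is mandated.
set_option linter.dupNamespace false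

namespace Summit.ValiantsHypothesis.ValiantsHypothesis.Theorems.NoValuativeFlip

open Literature.NumberTheory.DiophantineGeometry Literature.Computability.AlgebraicComplexity
open Summit.ValiantsHypothesis.ValiantsHypothesis.Theses.ValuativeGCT

/-- **Grenet, padded**: `per_n` has an affine determinantal representation of every size `m` with
`2ⁿ ≤ m + 1`, i.e. `m ≥ 2ⁿ - 1 ≥ dc(per_n)` (Grenet 2011 Thm. 1, tree
`determinantalComplexity_perPoly_le_holds`; the infimum `dc` is attained,
`hasDetRepr_determinantalComplexity_holds`, and representations pad, `HasDetRepr.mono_holds`).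
For `n = 0`, `per_0 = 1` is the determinant of the empty matrix. -/
theorem hasDetRepr_perPoly_of_two_pow_le {n m : ℕ} (hm : 2 ^ n ≤ m + 1) :
    HasDetRepr (perPoly (Fin n) ℂ) m := by
  rcases Nat.eq_zero_or_pos n with rfl | hn
  · have h0 : HasDetRepr (perPoly (Fin 0) ℂ) 0 := by
      refine ⟨Matrix.of fun i _ => i.elim0, fun i => i.elim0, ?_⟩
      rw [Matrix.det_isEmpty, perPoly, Matrix.permanent_isEmpty]
    exact HasDetRepr.mono_holds h0 (Nat.zero_le m)
  · have hdc := determinantalComplexity_perPoly_le_holds ℂ n hn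
    have hle : determinantalComplexity (perPoly (Fin n) ℂ) ≤ m := by
      have := Nat.one_le_two_pow (n := n)
      omega
    exact HasDetRepr.mono_holds (hasDetRepr_determinantalComplexity_holds _) hle

/-- For `2ⁿ ≤ m + 1` one has `n ≤ m` (since `n < 2ⁿ`). [folklore] -/
theorem le_of_two_pow_le_succ {n m : ℕ} (hm : 2 ^ n ≤ m + 1) : n ≤ m := by
  have := Nat.lt_two_pow_self (n := n)
  omega

/-- **No border obstruction beyond Grenet's bound**: for `2ⁿ ≤ m + 1` the padded permanent
`X₀₀^(m-n) per_n` lies in the orbit closure of `det_m` (in the lexicographically ordered matrix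
variables): Mulmuley–Sohoni 2001 Prop. 4.4 (`paddedPerPoly_mem_orbitClosure_detPoly_of_hasDetRepr_holds`)
applied to the padded Grenet representation, transported by `hasBorderDetRepr_iff_rename_holds`. -/
theorem paddedPerFormLex_mem_orbitClosure_detFormLex_of_two_pow_le {n m : ℕ} [NeZero m]
    (hm : 2 ^ n ≤ m + 1) :
    paddedPerFormLex ℂ n m ∈ orbitClosure (detFormLex ℂ m) :=
  (hasBorderDetRepr_iff_rename_holds (k := ℂ) n m).mp
    (paddedPerPoly_mem_orbitClosure_detPoly_of_hasDetRepr_holds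
      (hasDetRepr_perPoly_of_two_pow_le hm) (le_of_two_pow_le_succ hm))

/-- **No multiplicity obstruction beyond Grenet's bound** (`GCTMult.GctNoMultBarrier` with the
exponential threshold, unconditional): for `2ⁿ ≤ m + 1` and every weight `χ` of `GL_{m²}`,
`mult_χ ℂ[Δ(X₀₀^(m-n) per_n)] ≤ mult_χ ℂ[Δ(det_m)]`, by the multiplicity-obstruction principle
(`orbitMultiplicity_le_of_mem_orbitClosure_holds`, BLMW 2011 §1 / Bläser–Ikenmeyer 2025 §12.4)
and `paddedPerFormLex_mem_orbitClosure_detFormLex_of_two_pow_le`. -/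
theorem orbitMultiplicity_paddedPer_le_det_of_two_pow_le {n m : ℕ} [NeZero m]
    (hm : 2 ^ n ≤ m + 1) (χ : Weight (MatIdx m)) :
    orbitMultiplicity ℂ (paddedPerFormLex ℂ n m) m χ ≤ orbitMultiplicity ℂ (detFormLex ℂ m) m χ :=
  orbitMultiplicity_le_of_mem_orbitClosure_holds (detFormLex ℂ m) (paddedPerFormLex ℂ n m)
    (NeZero.ne m) (detFormLex_isHomogeneous ℂ m)
    (paddedPerFormLex_isHomogeneous ℂ (le_of_two_pow_le_succ hm))
    (paddedPerFormLex_mem_orbitClosure_detFormLex_of_two_pow_le hm) χ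

/-- **`NoValuativeFlip` beyond Grenet's bound, from `ValuativeBound`.** Given the route's
valuative bound `K_m(λ*) ≤ dim T_U(λ)` (stmt-ValiantsHypothesis-12625), the inequality of the
kill statement `NoValuativeFlip` (stmt-ValiantsHypothesis-12629, truncation `T_U(λ)` verbatim)
holds for every `n`, every `m` with `2ⁿ ≤ m + 1`, every centre `(U, r)` with ranks `≤ r` on `U`,
every `δ` and every `λ ⊢ m δ` with at most `m²` parts:
`mult_pp(λ*) ≤ K_m(λ*) ≤ dim T_U(λ)`. The item proper asks for the threshold `n ^ c₀`. -/
theorem noValuativeFlip_body_of_two_pow_le (hVB : ValuativeBound) {n : ℕ} (m : ℕ) [NeZero m]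
    (hm : 2 ^ n ≤ m + 1) (U : Submodule ℂ (MatIdx m → ℂ)) (r : ℕ)
    (hU : ∀ u ∈ U, (Matrix.of fun a b : Fin m => u (toLex (a, b))).rank ≤ r)
    (δ : ℕ) (lam : Nat.Partition (m * δ)) (hcard : lam.parts.card ≤ m * m) :
    let χ : Literature.NumberTheory.DiophantineGeometry.Weight (Literature.NumberTheory.DiophantineGeometry.MatIdx m) := (Literature.NumberTheory.DiophantineGeometry.Weight.dualOfPartition (m * m) lam).toMatIdx; let T : Submodule ℂ (MvPolynomial (Literature.NumberTheory.DiophantineGeometry.MatIdx m × Literature.NumberTheory.DiophantineGeometry.MatIdx m) ℂ) := MvPolynomial.homogeneousSubmodule (Literature.NumberTheory.DiophantineGeometry.MatIdx m × Literature.NumberTheory.DiophantineGeometry.MatIdx m) ℂ (m * δ) ⊓ ((MvPolynomial.vanishingIdeal ℂ {p : Literature.NumberTheory.DiophantineGeometry.MatIdx m × Literature.NumberTheory.DiophantineGeometry.MatIdx m → ℂ | ∀ j : Literature.NumberTheory.DiophantineGeometry.MatIdx m, (fun i => p (j, i)) ∈ U}) ^ (δ * (m - r))).restrictScalars ℂ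 ⊓ (⨅ (M : Matrix (Literature.NumberTheory.DiophantineGeometry.MatIdx m) (Literature.NumberTheory.DiophantineGeometry.MatIdx m) ℂ) (_ : Literature.Computability.AlgebraicComplexity.linSubst (Literature.NumberTheory.DiophantineGeometry.MatIdx m) ℂ M (Literature.NumberTheory.DiophantineGeometry.detFormLex ℂ m) = Literature.NumberTheory.DiophantineGeometry.detFormLex ℂ m), LinearMap.ker ((MvPolynomial.aeval (R := ℂ) fun p : Literature.NumberTheory.DiophantineGeometry.MatIdx m × Literature.NumberTheory.DiophantineGeometry.MatIdx m => ∑ l : Literature.NumberTheory.DiophantineGeometry.MatIdx m, M l p.2 • MvPolynomial.X (p.1, l)).toLinearMap - LinearMap.id (R := ℂ) (M := MvPolynomial (Literature.NumberTheory.DiophantineGeometry.MatIdx m × Literature.NumberTheory.DiophantineGeometry.MatIdx m) ℂ))) ⊓ (⨅ (g : Matrix.GeneralLinearGroup (Literature.NumberTheory.DiophantineGeometry.MatIdx m) ℂ) (_ : Literature.NumberTheory.DiophantineGeometry.IsUpperTriangular g), LinearMap.ker ((MvPolynomial.aeval (R := ℂ) fun p : Literature.NumberTheory.DiophantineGeometry.MatIdx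 m × Literature.NumberTheory.DiophantineGeometry.MatIdx m => ∑ l : Literature.NumberTheory.DiophantineGeometry.MatIdx m, ((g⁻¹ : Matrix.GeneralLinearGroup (Literature.NumberTheory.DiophantineGeometry.MatIdx m) ℂ) : Matrix (Literature.NumberTheory.DiophantineGeometry.MatIdx m) (Literature.NumberTheory.DiophantineGeometry.MatIdx m) ℂ) p.1 l • MvPolynomial.X (l, p.2)).toLinearMap - Literature.NumberTheory.DiophantineGeometry.weightChar χ g • LinearMap.id (R := ℂ) (M := MvPolynomial (Literature.NumberTheory.DiophantineGeometry.MatIdx m × Literature.NumberTheory.DiophantineGeometry.MatIdx m) ℂ))); Literature.NumberTheory.DiophantineGeometry.orbitMultiplicity ℂ (Literature.NumberTheory.DiophantineGeometry.paddedPerFormLex ℂ n m) m χ ≤ Module.finrank ℂ ↥T := by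
  intro χ T
  exact (orbitMultiplicity_paddedPer_le_det_of_two_pow_le hm χ).trans (hVB m U r hU δ lam hcard)

end Summit.ValiantsHypothesis.ValiantsHypothesis.Theorems.NoValuativeFlip
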